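import Summits.CriticalPhenomena.CardyFormulaZ2.Theorems.UniformBoxCrossing.Negative.FalseWithoutFKG
import Literature.Probability.Percolation.NearCriticalCorrelationLengthLower
import HarnessLib

/-!
# The Non-Slant kernel of line `Sketch` also fails beyond FKG
(negative-side support for crux `UniformBoxCrossing`, stmt-CriticalPhenomena-5476; cdisprove findings
`Cruxes/UniformBoxCrossing/Disproof.lean` §2d, landed verbatim by the line lead; part 5 of 5)

`nonSlant_false_without_FKG`: the line's kernel stub `stub_nonSlant` (B–R Non-Slant, `5|y₀-x₀| ≤ 3n`)
with `cornerPercolation t` replaced by `extCornerPercolation s`, `s ∈ [0,1]`, fails: at `s = 1`, in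
`[0,5m]²`, a top–bottom open path is an orbit ascent to the top row followed by a flat run of heads, so
either some bottom vertex's orbit makes `≥ 5m` north steps among its first `9m` or some top vertex
starts a run of `m+1` heads: `P ≤ (5m+1)(.946^m + 2^-(m+1)) → 0` (`laminated_nonSlant_le`). So the
kernel, like the crux, is reachable only through a quantitative use of `t ≤ 1`. Also
`uniformBoxCrossing_of_withoutFKG`: the extended statement is a strengthening of the crux.
-/

namespace Summit.CriticalPhenomena.CardyFormulaZ2.Theorems.UniformBoxCrossing.Negative

open MeasureTheory Filter Literature.Probability.Percolation Literature.Probability.LatticeModels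
open Summit.CriticalPhenomena.CardyFormulaZ2.Theses.CardySelfDualSegment
open scoped Topology

noncomputable section

/-! ### The kernel stub `stub_nonSlant` also fails beyond FKG: Non-Slant dies at the laminated
endpoint -/

/-- Orbit events with MANY north steps are covered by the cylinders of large patterns. -/
theorem orbitEvent_ge_subset (x : Site 2) (K : ℕ) (n : ℕ) :
    {S : Set (Site 2 × Fin 2) | x 1 + n ≤ lamOrbit (coins S) x K 1} ⊆
      ⋃ s ∈ (Finset.univ : Finset (Finset (Fin K))).filter (fun s => n ≤ s.card), patCyl x s := by
  intro S hS
  simp only [Set.mem_setOf_eq, lamOrbit_apply_one_eq] at hS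
  simp only [Set.mem_iUnion, Finset.mem_filter, Finset.mem_univ, true_and, exists_prop]
  exact ⟨patOf S x K, by exact_mod_cast (by linarith : (n : ℤ) ≤ (patOf S x K).card),
    mem_patCyl_patOf S x K⟩

/-- Counting large patterns by weighting: `y^(K-n) · #{s ⊆ Fin K : n ≤ |s|} ≤ (1 + y)^K` for
`0 < y ≤ 1`. -/
theorem card_filter_le_card_mul_le (K n : ℕ) {y : ℝ} (hy0 : 0 < y) (hy1 : y ≤ 1) :
    y ^ (K - n) *
        (((Finset.univ : Finset (Finset (Fin K))).filter (fun s => n ≤ s.card)).card : ℝ) ≤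
      (1 + y) ^ K := by
  set A := (Finset.univ : Finset (Finset (Fin K))).filter (fun s => n ≤ s.card) with hA
  have h1 : y ^ (K - n) * (A.card : ℝ) = ∑ s ∈ A, y ^ (K - n) := by
    rw [Finset.sum_const, nsmul_eq_mul, mul_comm]
  have h2 : ∑ s ∈ A, y ^ (K - n) ≤ ∑ s ∈ A, (1 : ℝ) ^ s.card * y ^ (K - s.card) := by
    refine Finset.sum_le_sum fun s hs => ?_
    have hsn : n ≤ s.card := (Finset.mem_filter.1 hs).2
    rw [one_pow, one_mul]
    exact pow_le_pow_of_le_one hy0.le hy1 (by omega)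
  have h3 : ∑ s ∈ A, (1 : ℝ) ^ s.card * y ^ (K - s.card) ≤
      ∑ s : Finset (Fin K), (1 : ℝ) ^ s.card * y ^ (K - s.card) :=
    Finset.sum_le_sum_of_subset_of_nonneg (Finset.filter_subset _ _) fun _ _ _ => by positivity
  rw [h1, ← Fin.sum_pow_mul_eq_add_pow (n := K) (1 : ℝ) y]
  exact h2.trans h3

/-- **Orbit bound, upper tail**: with fair coins, the orbit of `x` makes at least `5m` north steps
among its first `9m` steps with probability at most `((9/10)^9 (5/4)^4)^m`
(weighting with `y = 4/5`). -/
theorem real_orbitEvent_ge_le (p : Site 2 × Fin 2 → unitInterval) (hp : ∀ v, p (v, 0) = half)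
    (x : Site 2) (m : ℕ) :
    (prodBernoulli p).real {S | x 1 + 5 * m ≤ lamOrbit (coins S) x (9 * m) 1} ≤
      ((9 / 10 : ℝ) ^ 9 * (5 / 4 : ℝ) ^ 4) ^ m := by
  classical
  have hcount := card_filter_le_card_mul_le (9 * m) (5 * m) (y := (4 / 5 : ℝ)) (by norm_num)
    (by norm_num)
  have hsub : 9 * m - 5 * m = 4 * m := by omega
  rw [hsub, show (1 + 4 / 5 : ℝ) = 9 / 5 by norm_num] at hcount
  set A := (Finset.univ : Finset (Finset (Fin (9 * m)))).filter (fun s => 5 * m ≤ s.card) with hA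
  have h54 : (5 / 4 : ℝ) ^ (4 * m) * (4 / 5 : ℝ) ^ (4 * m) = 1 := by rw [← mul_pow]; norm_num
  have hcard : (A.card : ℝ) ≤ (5 / 4 : ℝ) ^ (4 * m) * (9 / 5 : ℝ) ^ (9 * m) :=
    calc (A.card : ℝ) = (5 / 4 : ℝ) ^ (4 * m) * ((4 / 5 : ℝ) ^ (4 * m) * A.card) := by
          rw [← mul_assoc, h54, one_mul]
      _ ≤ (5 / 4 : ℝ) ^ (4 * m) * (9 / 5 : ℝ) ^ (9 * m) := by gcongr
  calc (prodBernoulli p).real {S | x 1 + 5 * m ≤ lamOrbit (coins S) x (9 * m) 1}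
      ≤ (prodBernoulli p).real (⋃ s ∈ A, patCyl x s) :=
        measureReal_mono (orbitEvent_ge_subset x (9 * m) (5 * m)) (measure_ne_top _ _)
    _ ≤ ∑ s ∈ A, (prodBernoulli p).real (patCyl x s) := measureReal_biUnion_finset_le _ _
    _ = A.card * (1 / 2 : ℝ) ^ (9 * m) := by simp [real_patCyl p hp, Finset.sum_const]
    _ ≤ ((5 / 4 : ℝ) ^ (4 * m) * (9 / 5 : ℝ) ^ (9 * m)) * (1 / 2 : ℝ) ^ (9 * m) := by gcongr
    _ = ((9 / 10 : ℝ) ^ 9 * (5 / 4 : ℝ) ^ 4) ^ m := by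
        rw [pow_mul, pow_mul, pow_mul, ← mul_pow, ← mul_pow]
        congr 1
        norm_num

/-- A run of `d` heads to the east of `y`: a cylinder of probability `(1/2)^d`. -/
theorem real_eastRun (p : Site 2 × Fin 2 → unitInterval) (hp : ∀ v, p (v, 0) = half)
    (y : Site 2) (d : ℕ) :
    (prodBernoulli p).real {S | ∀ i : Fin d, (y + ![((i : ℕ) : ℤ), 0], (0 : Fin 2)) ∈ S} =
      (1 / 2 : ℝ) ^ d := by
  have hφ : Function.Injective fun i : Fin d => (y + ![((i : ℕ) : ℤ), 0], (0 : Fin 2)) := by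
    intro i j h
    simp only [Prod.mk.injEq, and_true, add_right_inj] at h
    have := congrFun h 0
    simp only [Matrix.cons_val_zero, Nat.cast_inj] at this
    exact Fin.ext this
  have h := prodBernoulli_real_cylinder_of_injective p hφ (fun _ => True)
  simp only [iff_true] at h
  rw [h]
  simp only [hp, Finset.prod_const, Finset.card_univ, Fintype.card_fin]
  congr 1
  have := ber_half_real_iff True
  simp only [iff_true] at this
  exact this

/-- Along an orbit segment without north steps the orbit moves east through heads. -/
theorem lamOrbit_flat_run (c : Set (Site 2)) (y : Site 2) {L : ℕ}
    (hflat : lamOrbit c y L 1 = y 1) :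
    ∀ i, i < L → lamOrbit c y i = y + ![(i : ℤ), 0] ∧ lamOrbit c y i ∈ c := by
  have hle : ∀ i, i ≤ L → lamOrbit c y i 1 = y 1 := fun i hi =>
    le_antisymm (hflat ▸ lamOrbit_one_mono c y hi) (le_lamOrbit_one c y i)
  intro i hi
  have hpos : lamOrbit c y i = y + ![(i : ℤ), 0] := by
    have hs := lamOrbit_sum c y i
    have h1 := hle i hi.le
    funext j
    fin_cases j
    · simp only [Fin.zero_eta, Pi.add_apply, Matrix.cons_val_zero]; omega
    · simp only [Fin.mk_one, Pi.add_apply, Matrix.cons_val_one, Matrix.cons_val_zero]; omega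
  refine ⟨hpos, ?_⟩
  by_contra hc
  have hstep : lamOrbit c y (i + 1) 1 = lamOrbit c y i 1 + 1 := by
    rw [lamOrbit_succ, lamStep_apply_one, if_neg hc]
  have := hle (i + 1) hi
  have := hle i hi.le
  omega

/-- `|topSide m n| ≤ m + 1`. -/
theorem card_topSide_le (m n : ℕ) : (topSide m n).card ≤ m + 1 := by
  have hsub : topSide m n ⊆ (Finset.range (m + 1)).image
      fun t : ℕ => (![(t : ℤ), (n : ℤ)] : Site 2) := by
    intro x hx
    simp only [topSide, Finset.mem_filter, mem_rectangle_iff] at hx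
    obtain ⟨⟨h0, h1, -, -⟩, hx1⟩ := hx
    refine Finset.mem_image.2 ⟨(x 0).toNat, Finset.mem_range.2 (by omega), ?_⟩
    ext i; fin_cases i
    · simp only [Fin.zero_eta, Matrix.cons_val_zero]; exact Int.toNat_of_nonneg h0
    · simp [hx1]
  exact (Finset.card_le_card hsub).trans (Finset.card_image_le.trans (Finset.card_range _).le)

/-- **Deterministic core for Non-Slant at the laminated endpoint.** If the laminated configuration
has an open path inside `[0, 5m]²` from a bottom vertex `x` to a top vertex `y` with
`5 |y₀ - x₀| ≤ 3 · 5m`, then either the orbit of some bottom vertex makes `≥ 5m` north steps among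
its first `9m` steps, or some top vertex starts a run of `m + 1` heads to its east. -/
theorem lam_nonSlant_alternative (c : Set (Site 2)) (m : ℕ)
    (h : ∃ x ∈ bottomSide (5 * m) (5 * m), ∃ y ∈ topSide (5 * m) (5 * m),
      5 * |y 0 - x 0| ≤ 3 * ((5 * m : ℕ) : ℤ) ∧
        lamConfig c ∈ openConnIn (↑(rectangle (5 * m) (5 * m))) x y) :
    (∃ x ∈ bottomSide (5 * m) (5 * m), x 1 + 5 * m ≤ lamOrbit c x (9 * m) 1) ∨
      (∃ y ∈ topSide (5 * m) (5 * m), ∀ i : Fin (m + 1), lamOrbit c y i ∈ c ∧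
        lamOrbit c y i = y + ![((i : ℕ) : ℤ), 0]) := by
  classical
  obtain ⟨x, hx, y, hy, hslant, hxT, hyT, hreach⟩ := h
  obtain ⟨W⟩ := hreach
  set p := W.toPath with hp
  obtain ⟨k, hk, hasc, hdesc⟩ := path_unimodal c _ p.1 p.2
  have hx1 : x 1 = 0 := (Finset.mem_filter.1 hx).2
  have hy1 : y 1 = 5 * m := by
    have := (Finset.mem_filter.1 hy).2; exact_mod_cast this
  -- the peak `mm`
  set mm := lamOrbit c x k with hmm
  have hpeak_x : (p.1.getVert k : Site 2) = mm := hasc k le_rfl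
  have hpeak_y : mm = lamOrbit c y (p.1.length - k) := by rw [← hpeak_x, hdesc k le_rfl hk]
  have hmmT : mm ∈ (↑(rectangle (5 * m) (5 * m)) : Set (Site 2)) := by
    rw [← hpeak_x]; exact (p.1.getVert k).2
  have hmm1 : mm 1 = 5 * m := by
    have h1 : mm 1 ≤ 5 * m := by
      have := (mem_rectangle_iff.1 (Finset.mem_coe.1 hmmT)).2.2.2; exact_mod_cast this
    have h2 : y 1 ≤ mm 1 := by rw [hpeak_y]; exact le_lamOrbit_one c y _
    omega
  have hsum := lamOrbit_sum c x k
  rw [← hmm] at hsum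
  -- east count at the peak
  by_cases hE : mm 0 - x 0 ≤ 4 * m
  · left
    refine ⟨x, hx, ?_⟩
    have hk9 : k ≤ 9 * m := by
      have : (k : ℤ) ≤ 9 * m := by omega
      exact_mod_cast this
    calc x 1 + 5 * m = mm 1 := by omega
      _ ≤ lamOrbit c x (9 * m) 1 := lamOrbit_one_mono c x hk9
  · right
    refine ⟨y, hy, ?_⟩
    push Not at hE
    -- the descent from the peak to `y` is a flat run of length `mm 0 - y 0 > m`
    have hflat : lamOrbit c y (p.1.length - k) 1 = y 1 := by rw [← hpeak_y]; omega
    have hlen : (m : ℤ) + 1 ≤ (p.1.length - k : ℕ) := by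
      have hs := lamOrbit_sum c y (p.1.length - k)
      rw [← hpeak_y] at hs
      have habs : y 0 - x 0 ≤ 3 * m := by
        have := abs_le.1 (show |y 0 - x 0| ≤ 3 * m by omega)
        omega
      omega
    intro i
    have hi : (i : ℕ) < p.1.length - k := by
      have := i.2; omega
    obtain ⟨hpos, hc⟩ := lamOrbit_flat_run c y hflat i hi
    exact ⟨hc, hpos⟩

/-- **Non-Slant fails at the laminated endpoint.** The `extCornerPercolation 1`-probability of
B–R's Non-Slant event in `[0, 5m]²` (a top–bottom open path whose endpoint abscissae differ by at
most `3/5` of the side) is at most `(5m + 1) (((9/10)^9 (5/4)^4)^m + (1/2)^(m+1))`. -/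
theorem laminated_nonSlant_le (m : ℕ) :
    (extCornerPercolation 1).real {ω | ∃ x ∈ bottomSide (5 * m) (5 * m),
        ∃ y ∈ topSide (5 * m) (5 * m), 5 * |y 0 - x 0| ≤ 3 * ((5 * m : ℕ) : ℤ) ∧
          ω ∈ openConnIn (↑(rectangle (5 * m) (5 * m))) x y} ≤
      (5 * m + 1) * (((9 / 10 : ℝ) ^ 9 * (5 / 4 : ℝ) ^ 4) ^ m + (1 / 2 : ℝ) ^ (m + 1)) := by
  classical
  set n := 5 * m with hn
  set E : Set (BondConfig (Site 2)) := {ω | ∃ x ∈ bottomSide n n, ∃ y ∈ topSide n n,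
    5 * |y 0 - x 0| ≤ 3 * ((n : ℕ) : ℤ) ∧ ω ∈ openConnIn (↑(rectangle n n)) x y} with hE
  have hEm : MeasurableSet E := by
    have : E = ⋃ x ∈ bottomSide n n, ⋃ y ∈ topSide n n,
        ({ω : BondConfig (Site 2) | 5 * |y 0 - x 0| ≤ 3 * ((n : ℕ) : ℤ)} ∩
          openConnIn (↑(rectangle n n)) x y) := by
      ext ω
      simp only [hE, Set.mem_setOf_eq, Set.mem_iUnion, Set.mem_inter_iff, exists_prop]
    rw [this]
    refine MeasurableSet.biUnion (Finset.countable_toSet _) fun x _ =>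
      MeasurableSet.biUnion (Finset.countable_toSet _) fun y _ =>
        (MeasurableSet.const _).inter (measurableSet_openConnIn_of_countable _ _ _)
  rw [extCornerPercolation, map_measureReal_apply measurable_cornerConfig hEm]
  set μ := prodBernoulli (extCornerParam 1) with hμ
  set G : Set (Set (Site 2 × Fin 2)) := {S | ∀ v, (v, (1 : Fin 2)) ∈ S} with hG
  set B₁ : Site 2 → Set (Set (Site 2 × Fin 2)) :=
    fun x => {S | x 1 + 5 * m ≤ lamOrbit (coins S) x (9 * m) 1} with hB₁
  set B₂ : Site 2 → Set (Set (Site 2 × Fin 2)) :=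
    fun y => {S | ∀ i : Fin (m + 1), (y + ![((i : ℕ) : ℤ), 0], (0 : Fin 2)) ∈ S} with hB₂
  have hsub : cornerConfig ⁻¹' E ⊆
      ((⋃ x ∈ bottomSide n n, B₁ x) ∪ (⋃ y ∈ topSide n n, B₂ y)) ∪ Gᶜ := by
    intro S hS
    by_cases hSG : S ∈ G
    · left
      have hlam : lamConfig (coins S) ∈ E := by
        have := cornerConfig_eq_lamConfig hSG
        rw [Set.mem_preimage, this] at hS
        exact hS
      rcases lam_nonSlant_alternative (coins S) m hlam with ⟨x, hx, hbad⟩ | ⟨y, hy, hrun⟩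
      · left
        simp only [Set.mem_iUnion, exists_prop]
        exact ⟨x, hx, hbad⟩
      · right
        simp only [Set.mem_iUnion, exists_prop]
        refine ⟨y, hy, fun i => ?_⟩
        have := (hrun i)
        rw [this.2] at this
        exact this.1
    · exact Or.inr hSG
  have hG0 : μ.real Gᶜ = 0 := by
    have h := ae_forall_splitting_mem
    rw [ae_iff] at h
    rw [measureReal_eq_zero_iff (measure_ne_top _ _)]
    exact h
  have hcardB : ((bottomSide n n).card : ℝ) ≤ 5 * m + 1 := by
    have := card_bottomSide_le n n; rw [hn] at this ⊢; exact_mod_cast this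
  have hcardT : ((topSide n n).card : ℝ) ≤ 5 * m + 1 := by
    have := card_topSide_le n n; rw [hn] at this ⊢; exact_mod_cast this
  calc μ.real (cornerConfig ⁻¹' E)
      ≤ μ.real (((⋃ x ∈ bottomSide n n, B₁ x) ∪ (⋃ y ∈ topSide n n, B₂ y)) ∪ Gᶜ) :=
        measureReal_mono hsub (measure_ne_top _ _)
    _ ≤ μ.real ((⋃ x ∈ bottomSide n n, B₁ x) ∪ (⋃ y ∈ topSide n n, B₂ y)) + μ.real Gᶜ :=
        measureReal_union_le _ _
    _ ≤ (μ.real (⋃ x ∈ bottomSide n n, B₁ x) + μ.real (⋃ y ∈ topSide n n, B₂ y)) + 0 := by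
        rw [hG0]; gcongr; exact measureReal_union_le _ _
    _ ≤ (∑ x ∈ bottomSide n n, μ.real (B₁ x) + ∑ y ∈ topSide n n, μ.real (B₂ y)) + 0 := by
        gcongr <;> exact measureReal_biUnion_finset_le _ _
    _ ≤ (∑ x ∈ bottomSide n n, ((9 / 10 : ℝ) ^ 9 * (5 / 4 : ℝ) ^ 4) ^ m +
          ∑ y ∈ topSide n n, (1 / 2 : ℝ) ^ (m + 1)) + 0 := by
        gcongr with x hx y hy
        · exact real_orbitEvent_ge_le _ (fun v => extCornerParam_apply_zero 1 v) x m
        · exact (real_eastRun _ (fun v => extCornerParam_apply_zero 1 v) y (m + 1)).le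
    _ ≤ (5 * m + 1) * (((9 / 10 : ℝ) ^ 9 * (5 / 4 : ℝ) ^ 4) ^ m + (1 / 2 : ℝ) ^ (m + 1)) := by
        rw [Finset.sum_const, Finset.sum_const, add_zero, nsmul_eq_mul, nsmul_eq_mul]
        have h1 : (0 : ℝ) ≤ ((9 / 10 : ℝ) ^ 9 * (5 / 4 : ℝ) ^ 4) ^ m := by positivity
        have h2 : (0 : ℝ) ≤ (1 / 2 : ℝ) ^ (m + 1) := by positivity
        nlinarith

/-- The Non-Slant lamination bound tends to `0`. -/
theorem tendsto_laminated_nonSlant_bound :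
    Tendsto (fun m : ℕ => (5 * m + 1) *
      (((9 / 10 : ℝ) ^ 9 * (5 / 4 : ℝ) ^ 4) ^ m + (1 / 2 : ℝ) ^ (m + 1))) atTop (𝓝 0) := by
  set r : ℝ := (9 / 10 : ℝ) ^ 9 * (5 / 4 : ℝ) ^ 4 with hr
  have hr0 : 0 ≤ r := by positivity
  have hr1 : r < 1 := by norm_num [hr]
  have h1 := tendsto_self_mul_const_pow_of_lt_one hr0 hr1
  have h2 := tendsto_pow_atTop_nhds_zero_of_lt_one hr0 hr1
  have h3 := tendsto_self_mul_const_pow_of_lt_one (r := (1 / 2 : ℝ)) (by norm_num) (by norm_num)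
  have h4 := tendsto_pow_atTop_nhds_zero_of_lt_one (r := (1 / 2 : ℝ)) (by norm_num) (by norm_num)
  have h := ((h1.const_mul 5).add h2).add (((h3.const_mul 5).add h4).mul_const (1 / 2))
  simp only [mul_zero, add_zero, zero_mul] at h
  refine h.congr fun m => ?_
  rw [pow_succ]
  ring

/-- **The kernel stub beyond FKG is false**: `stub_nonSlant` of line `Sketch` with
`cornerPercolation t, t ∈ [0,1]` replaced by `extCornerPercolation s, s ∈ [0,1]` fails (witness
`s = 1`, squares of side `5m`). So the Non-Slant kernel, like the crux, can only be proved by a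
quantitative use of `t ≤ 1` (no shear-blind / FKG-free argument reaches it). -/
theorem nonSlant_false_without_FKG :
    ¬ ∃ c : ℝ, 0 < c ∧ ∃ n₀ : ℕ, ∀ (s : unitInterval) (n : ℕ), n₀ ≤ n →
      c ≤ (extCornerPercolation s).real {ω | ∃ x ∈ bottomSide n n, ∃ y ∈ topSide n n,
        5 * |y 0 - x 0| ≤ 3 * (n : ℤ) ∧ ω ∈ openConnIn (↑(rectangle n n)) x y} := by
  rintro ⟨c, hc, n₀, h⟩
  obtain ⟨M, hM⟩ :=
    (tendsto_laminated_nonSlant_bound.eventually (gt_mem_nhds hc)).exists_forall_of_atTop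
  set m := max M n₀ with hm
  have h1 := h 1 (5 * m) (by omega)
  have h2 := laminated_nonSlant_le m
  have h3 := hM m (le_max_left _ _)
  push_cast at h1 h2
  linarith

/-- The extended statement IS a strengthening of the crux (instantiate `s = t/2`). -/
theorem uniformBoxCrossing_of_withoutFKG (h : UniformBoxCrossingWithoutFKG) : UniformBoxCrossing := by
  show ∀ ρ : ℝ, 0 < ρ → ∃ c > 0, ∃ n₀ : ℕ, ∀ t : unitInterval,
    BoxCrossingBounds (cornerPercolation t) squareLatticeEmbedding.z ρ c n₀
  intro ρ hρ
  obtain ⟨c, hc, n₀, hb⟩ := h ρ hρ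
  exact ⟨c, hc, n₀, fun t => by rw [← extCornerPercolation_half_mul]; exact hb (half * t)⟩

end

end Summit.CriticalPhenomena.CardyFormulaZ2.Theorems.UniformBoxCrossing.Negative
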